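import Summits.QuantumFields.YangMills.Theorems.LangevinControlUVFemtoCurvatureSkewnessDefs
import Summits.QuantumFields.YangMills.Theorems.FemtoCurvatureSkewness.Negative.PackagePinsScale

/-!
# Route `LangevinControlUV`, crux `FemtoCurvatureSkewness` (stmt-QuantumFields-9365): the ∃-bundled form of the crux is
# EXACTLY fixed-torus eventual non-vanishing of `κ₃` (no ultraviolet engine needed)

Lead c3 of line `coupling-cubic-response` (prover-line-stmt-QuantumFields-9365-c3-0, 2026-08-16), `--supports stmt-QuantumFields-9365`.

The ∃-bundled (assembly-sufficient, `yangMills_of_R1` p115434) form of the crux is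
`SkewnessForPackageMap := ∀ G simple, ∀ r, (∃ a, TwoPointPackage r a) → ∃ a, TwoPointPackage r a ∧ SkewnessPackage r a`
(`Theorems/LangevinControlUVFemtoCurvatureSkewnessDefs.lean`).  Leads c1/c2 certified it modulo the line's ENGINE stub alone
(`skewnessForPackageMap_of : MarkedCouplingDominance → SkewnessForPackageMap`, p111143).  This file shows, kernel-checked and with
NO stub, that the engine is far more than R1 needs:

* `skewnessForPackageMap_iff_eventually_ne_zero` — **R1 ⟺ for every compact simple `G` and every `r` carrying SOME two-point
  package map, FIXED-TORUS EVENTUAL NON-VANISHING `∀ L ≥ 8n ≥ 8, ∀ᶠ β → ∞, κ₃(L, β, n) ≠ 0`** — a statement about the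
  weak-coupling (Laplace / toron) asymptotics of Wilson's measure on ONE finite torus at a time; no relation between `L`, `n`, `β`,
  no shape function, no unit map, no uniformity in the volume.
  (→) is the landed `eventually_kappa3_ne_zero` (p74674).  (←) is `exists_package_and_skewness_of_eventually_ne_zero`: from the
  eventual non-vanishing choose thresholds and assemble a monotone `B : ℕ → ℝ`, `B L ≥ L`, with `κ₃(L, β, n) ≠ 0` whenever
  `β ≥ B L`, `1 ≤ n ≤ L/8` (`exists_kappa3_threshold`); let `N β := sSup {L | B L ≤ β}` (finite set; `N → ∞`); take the landed TWO-SIDED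
  WILD map `g/2 ≤ a ≤ g` (`exists_wildMap_two_sided`, p94300) for the envelope `g := a₀ + 4/(N β + 1)` of the given package map
  `a₀`: then `a₀ ≤ 2a`, so `a₀`'s package TRANSFERS to `a` verbatim (`twoPointPackage_transfer`, p94300 — bookkeeping, no physics),
  while every femto box of `a` (`L·a β ≤ 1`) has `L ≤ N β`, hence `B L ≤ β`, hence `κ₃ ≠ 0` at every admissible triple; since the
  level sets of `a` are singletons, each level `{n·a β = s}` carries finitely many volumes `L`, and `Γ₃(s)` is the finite minimum of
  `n¹²|κ₃|` over them (`skewnessPackage_iff_levelwise`, p74674).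
* `eventually_ne_zero_of_markedCouplingDominance` — the line's engine stub E implies that eventual non-vanishing (it forces
  `κ₃ > 0` on the femto boxes of its own honest map, `kappa3_pos_of_dominance`), so c1's `skewnessForPackageMap_of` factors
  through this file: E ⟹ eventual non-vanishing ⟹ R1.
* `eventually_ne_zero_of_femtoCurvatureSkewness` — the TYPED `∀ a` crux implies the same eventual non-vanishing (landing the
  disprover's work-file `crux_forces_eventual_nonvanishing`); its surplus over R1 is the a-free INFRARED non-vanishing of
  `Negative/GlobalNonvanishingOfCrux.lean` (p115717).
* `eventually_ne_zero_of_leadingOrder` — the shape of a line for the restated item: a non-zero leading weak-coupling coefficient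
  `βᵖ·κ₃(L, β, n) → T ≠ 0` on each torus gives the eventual non-vanishing (trivial; recorded to fix the target of such a line).

So the irreducible content of ANY restatement of item 9365 that keeps the route's assembly is the fixed-torus weak-coupling
non-degeneracy of the plaquette skewness — for the planners: restate 9365 as the right-hand side of
`skewnessForPackageMap_iff_eventually_ne_zero` (exact Lean below), whose natural line is fixed-torus semiclassics (singular Laplace
asymptotics on the flat-connection variety, torons included), not a UV engine.  Pure logic + the landed wild-map toolkit; nothing
is asserted, no `sorry`, no new definition.
-/

set_option autoImplicit false

noncomputable section

namespace Summit.QuantumFields.YangMills.Cruxes.FemtoCurvatureSkewness.CouplingCubicResponse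

open MeasureTheory Filter Topology
open scoped BigOperators
open Literature.MathematicalPhysics.QuantumFieldTheory
open Summit.QuantumFields.YangMills.Theses.LangevinControlUV (FemtoCurvatureSkewness)
open Summit.QuantumFields.YangMills.Theorems.FemtoCurvatureSkewness.Negative
  (plaq wE wCov kappa3 TwoPointPackage SkewnessPackage level_mem_window eventually_kappa3_ne_zero
    skewnessPackage_iff_levelwise exists_wildMap_two_sided twoPointPackage_transfer femtoCurvatureSkewness_iff)

section Core

variable {G : Type} [Group G] [TopologicalSpace G] [IsTopologicalGroup G] [CompactSpace G]
  [MeasurableSpace G] [BorelSpace G]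

/-- **A monotone threshold.**  Fixed-torus eventual non-vanishing yields `B : ℕ → ℝ`, monotone, `B L ≥ L`, such that
`κ₃(L, β, n) ≠ 0` for every `β ≥ B L` and every `1 ≤ n ≤ L/8` (finitely many thresholds per volume, summed up). -/
theorem exists_kappa3_threshold (r : LatticeRep G)
    (hev : ∀ (L : ℕ) [NeZero L] (n : ℕ), 1 ≤ n → 8 * n ≤ L → ∀ᶠ β in atTop, kappa3 r L β n ≠ 0) :
    ∃ B : ℕ → ℝ, Monotone B ∧ (∀ L : ℕ, (L : ℝ) ≤ B L) ∧
      ∀ (L : ℕ) [NeZero L] (β : ℝ) (n : ℕ), B L ≤ β → 1 ≤ n → 8 * n ≤ L → kappa3 r L β n ≠ 0 := by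
  classical
  -- one threshold per `(L, n)` (junk `0` off the admissible range)
  have hb : ∀ L n : ℕ, ∃ b : ℝ, ∀ [NeZero L], 1 ≤ n → 8 * n ≤ L → ∀ β : ℝ, b ≤ β → kappa3 r L β n ≠ 0 := by
    intro L n
    by_cases hL : L = 0
    · refine ⟨0, ?_⟩
      intro hLz
      exact absurd hL hLz.ne
    · haveI : NeZero L := ⟨hL⟩
      by_cases hn : 1 ≤ n ∧ 8 * n ≤ L
      · obtain ⟨b, hb⟩ := Filter.eventually_atTop.1 (hev L n hn.1 hn.2)
        exact ⟨b, fun _ _ β hβ => hb β hβ⟩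
      · refine ⟨0, ?_⟩
        intro _ h1 h8 β _
        exact absurd ⟨h1, h8⟩ hn
  choose b hb using hb
  refine ⟨fun L => (L : ℝ) + ∑ L' ∈ Finset.range (L + 1), ∑ n ∈ Finset.range (L' + 1), |b L' n|, ?_, ?_, ?_⟩
  · -- monotone
    intro L₁ L₂ hL
    have h1 : (L₁ : ℝ) ≤ L₂ := by exact_mod_cast hL
    have h2 : ∑ L' ∈ Finset.range (L₁ + 1), ∑ n ∈ Finset.range (L' + 1), |b L' n| ≤
        ∑ L' ∈ Finset.range (L₂ + 1), ∑ n ∈ Finset.range (L' + 1), |b L' n| := by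
      apply Finset.sum_le_sum_of_subset_of_nonneg
      · exact Finset.range_mono (by omega)
      · intro L' _ _
        exact Finset.sum_nonneg fun n _ => abs_nonneg _
    exact add_le_add h1 h2
  · -- `B L ≥ L`
    intro L
    have : 0 ≤ ∑ L' ∈ Finset.range (L + 1), ∑ n ∈ Finset.range (L' + 1), |b L' n| :=
      Finset.sum_nonneg fun L' _ => Finset.sum_nonneg fun n _ => abs_nonneg _
    linarith
  · -- thresholds dominated
    intro L _ β n hβ hn h8
    have hnL : n ∈ Finset.range (L + 1) := Finset.mem_range.2 (by omega)
    have hLL : L ∈ Finset.range (L + 1) := Finset.mem_range.2 (by omega)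
    have h1 : |b L n| ≤ ∑ n' ∈ Finset.range (L + 1), |b L n'| :=
      Finset.single_le_sum (f := fun n' => |b L n'|) (fun _ _ => abs_nonneg _) hnL
    have h2 : ∑ n' ∈ Finset.range (L + 1), |b L n'| ≤
        ∑ L' ∈ Finset.range (L + 1), ∑ n' ∈ Finset.range (L' + 1), |b L' n'| :=
      Finset.single_le_sum (f := fun L' => ∑ n' ∈ Finset.range (L' + 1), |b L' n'|)
        (fun _ _ => Finset.sum_nonneg fun _ _ => abs_nonneg _) hLL
    have h3 : b L n ≤ |b L n| := le_abs_self _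
    have h4 : (0 : ℝ) ≤ L := Nat.cast_nonneg L
    exact hb L n hn h8 β (by linarith)

/-- **Eventual non-vanishing + ONE package map ⇒ a package map WITH its skewness package** (the heart of (←)).
The new map is the landed two-sided wild map squeezed under `g := a₀ + 4/(N β + 1)`, `N β := sSup {L | B L ≤ β}` for the
threshold `B` of `exists_kappa3_threshold`: `a₀ ≤ 2a` transfers the package (`twoPointPackage_transfer`), `a ≥ 2/(N β + 1)` confines the
femto boxes `L·a β ≤ 1` to `L ≤ N β` where `κ₃ ≠ 0`, and singleton level sets make `Γ₃` a finite minimum. -/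
theorem exists_package_and_skewness_of_eventually_ne_zero (r : LatticeRep G) {a₀ : ℝ → ℝ}
    (h₀ : TwoPointPackage r a₀)
    (hev : ∀ (L : ℕ) [NeZero L] (n : ℕ), 1 ≤ n → 8 * n ≤ L → ∀ᶠ β in atTop, kappa3 r L β n ≠ 0) :
    ∃ a : ℝ → ℝ, (∀ β, a₀ β ≤ 2 * a β) ∧ TwoPointPackage r a ∧ SkewnessPackage r a := by
  classical
  obtain ⟨B, hBmono, hBge, hB⟩ := exists_kappa3_threshold r hev
  obtain ⟨Γ₀, β₀, ℓ₀, c, C, -, -, ha₀, ha₀0, -⟩ := id h₀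
  -- the cap `N β := sSup {L | B L ≤ β}`
  let S : ℝ → Set ℕ := fun β => {L | B L ≤ β}
  have hSbdd : ∀ β, BddAbove (S β) := by
    intro β
    refine ⟨⌊max β 0⌋₊, fun L hL => ?_⟩
    have hL' : (L : ℝ) ≤ β := (hBge L).trans hL
    exact Nat.le_floor (hL'.trans (le_max_left _ _))
  let N : ℝ → ℕ := fun β => sSup (S β)
  have hN1 : ∀ (L : ℕ) (β : ℝ), B L ≤ β → L ≤ N β := fun L β hL => le_csSup (hSbdd β) hL
  have hN2 : ∀ (β : ℝ) (L : ℕ), 1 ≤ L → L ≤ N β → B L ≤ β := by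
    intro β L hL1 hLN
    have hne : (S β).Nonempty := by
      by_contra hemp
      rw [Set.not_nonempty_iff_eq_empty] at hemp
      have : N β = 0 := by
        show sSup (S β) = 0
        rw [hemp, csSup_empty]
        rfl
      omega
    have hmem : N β ∈ S β := Nat.sSup_mem hne (hSbdd β)
    exact (hBmono hLN).trans hmem
  have hNlim : Tendsto N atTop atTop :=
    tendsto_atTop.2 fun L => eventually_atTop.2 ⟨B L, fun β hβ => hN1 L β hβ⟩
  -- the envelope and the wild map
  let g : ℝ → ℝ := fun β => a₀ β + 4 / ((N β : ℝ) + 1)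
  have hNpos : ∀ β, (0 : ℝ) < (N β : ℝ) + 1 := fun β => by positivity
  have hgpos : ∀ β, 0 < g β := fun β => add_pos (ha₀ β) (div_pos (by norm_num) (hNpos β))
  have hg0 : Tendsto g atTop (𝓝 0) := by
    have h1 : Tendsto (fun β => (N β : ℝ) + 1) atTop atTop :=
      (tendsto_natCast_atTop_atTop.comp hNlim).atTop_add tendsto_const_nhds
    have h2 : Tendsto (fun β => 4 / ((N β : ℝ) + 1)) atTop (𝓝 0) := by
      simpa [div_eq_mul_inv] using (tendsto_inv_atTop_zero.comp h1).const_mul (4 : ℝ)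
    simpa [g] using ha₀0.add h2
  obtain ⟨a, ha, hag, hga, huniq, hdist⟩ := exists_wildMap_two_sided g hgpos
  have ha0 : Tendsto a atTop (𝓝 0) :=
    tendsto_of_tendsto_of_tendsto_of_le_of_le tendsto_const_nhds hg0 (fun β => (ha β).le) hag
  have hdom : ∀ β, a₀ β ≤ 2 * a β := fun β =>
    le_trans (le_add_of_nonneg_right (div_pos (by norm_num) (hNpos β)).le) (hga β)
  have hlow : ∀ β, 2 / ((N β : ℝ) + 1) ≤ a β := fun β => by
    have h1 : 4 / ((N β : ℝ) + 1) ≤ g β := le_add_of_nonneg_left (ha₀ β).le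
    have h2 := hga β
    have : 4 / ((N β : ℝ) + 1) = 2 * (2 / ((N β : ℝ) + 1)) := by ring
    linarith
  -- femto boxes of `a` (with `ℓ₁ = 1`) live below the cap
  have hcap : ∀ (L : ℕ) (β : ℝ), 1 ≤ L → (L : ℝ) * a β ≤ 1 → L ≤ N β := by
    intro L β hL1 hL
    have h1 : (L : ℝ) * (2 / ((N β : ℝ) + 1)) ≤ 1 :=
      le_trans (mul_le_mul_of_nonneg_left (hlow β) (Nat.cast_nonneg L)) hL
    have h2 : 2 * (L : ℝ) ≤ (N β : ℝ) + 1 := by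
      rw [mul_div_assoc'] at h1
      rw [div_le_one (hNpos β)] at h1
      linarith
    have h3 : 2 * L ≤ N β + 1 := by exact_mod_cast h2
    omega
  refine ⟨a, hdom, twoPointPackage_transfer r h₀ ha ha0 (M := 2) (by norm_num) hdom huniq hdist, ?_⟩
  -- the skewness package, levelwise
  rw [skewnessPackage_iff_levelwise r ha]
  refine ⟨0, 1, one_pos, fun s hs _ => ?_⟩
  by_cases hlev : ∃ p : ℕ × ℝ, 1 ≤ p.1 ∧ (p.1 : ℝ) * a p.2 = s
  · obtain ⟨⟨n₀, β'⟩, hn₀, hs₀⟩ := hlev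
    -- the finitely many admissible volumes on this level, and the minimum of `n¹²|κ₃|` over them
    let f : ℕ → ℝ := fun L => if hL : L = 0 then 1 else
      (haveI : NeZero L := ⟨hL⟩; (n₀ : ℝ) ^ 12 * |kappa3 r L β' n₀|)
    let F : Finset ℕ := Finset.Icc (8 * n₀) (N β')
    have hfpos : ∀ L ∈ F, 0 < f L := by
      intro L hL
      obtain ⟨h8, hLN⟩ := Finset.mem_Icc.1 hL
      have hL0 : L ≠ 0 := by omega
      haveI : NeZero L := ⟨hL0⟩
      have hne : kappa3 r L β' n₀ ≠ 0 := hB L β' n₀ (hN2 β' L (by omega) hLN) hn₀ h8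
      have hval : f L = (n₀ : ℝ) ^ 12 * |kappa3 r L β' n₀| := by simp only [f, dif_neg hL0]
      rw [hval]
      have hn' : (0 : ℝ) < n₀ := by exact_mod_cast hn₀
      exact mul_pos (by positivity) (abs_pos.2 hne)
    by_cases hF : F.Nonempty
    · refine ⟨F.inf' hF f, (Finset.lt_inf'_iff hF).2 hfpos, ?_⟩
      intro L _ β n _ hL hn h8 hsn
      -- the level is a singleton: `(β, n) = (β', n₀)`
      obtain ⟨hββ, hnn⟩ := huniq β β' n n₀ hn hn₀ (hsn.trans hs₀.symm)
      subst hββ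
      subst hnn
      have hLN : L ≤ N β := hcap L β (by omega) hL
      have hLF : L ∈ F := Finset.mem_Icc.2 ⟨h8, hLN⟩
      have hL0 : L ≠ 0 := by omega
      have hval : f L = (n : ℝ) ^ 12 * |kappa3 r L β n| := by simp only [f, dif_neg hL0]
      exact (Finset.inf'_le f hLF).trans hval.le
    · -- no admissible volume on this level
      refine ⟨1, one_pos, ?_⟩
      intro L _ β n _ hL hn h8 hsn
      obtain ⟨hββ, hnn⟩ := huniq β β' n n₀ hn hn₀ (hsn.trans hs₀.symm)
      subst hββ
      subst hnn
      have hLN : L ≤ N β := hcap L β (by omega) hL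
      exact absurd ⟨L, Finset.mem_Icc.2 ⟨h8, hLN⟩⟩ hF
  · -- no level at `s` at all
    refine ⟨1, one_pos, ?_⟩
    intro L _ β n _ _ hn _ hsn
    exact absurd ⟨(n, β), hn, hsn⟩ hlev

end Core

/-! ## R1 ⟺ fixed-torus eventual non-vanishing (given a package map) -/

/-- **(←) R1 from eventual non-vanishing**: if for every compact simple `G` and every `r` with some package map the cumulant is
eventually non-zero on every fixed torus, then `SkewnessForPackageMap` holds — with NO ultraviolet engine. -/
theorem skewnessForPackageMap_of_eventually_ne_zero
    (hev : ∀ (G : Type) [Group G] [TopologicalSpace G] [IsTopologicalGroup G] [CompactSpace G],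
      IsCompactSimpleLieGroup G →
        letI : MeasurableSpace G := borel G
        haveI : BorelSpace G := ⟨rfl⟩
        ∀ (r : LatticeRep G), (∃ a : ℝ → ℝ, TwoPointPackage r a) →
          ∀ (L : ℕ) [NeZero L] (n : ℕ), 1 ≤ n → 8 * n ≤ L → ∀ᶠ β in atTop, kappa3 r L β n ≠ 0) :
    SkewnessForPackageMap := by
  intro G _ _ _ _ hG
  letI : MeasurableSpace G := borel G
  haveI : BorelSpace G := ⟨rfl⟩
  intro r hex
  obtain ⟨a₀, h₀⟩ := hex
  obtain ⟨a, -, hP, hS⟩ :=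
    exists_package_and_skewness_of_eventually_ne_zero r h₀ (fun L _ n hn h8 => hev G hG r ⟨a₀, h₀⟩ L n hn h8)
  exact ⟨a, hP, hS⟩

/-- **(→) eventual non-vanishing from R1**: the package map R1 returns is positive and tends to `0`, so its skewness package
forces `κ₃ ≠ 0` eventually on every fixed torus (landed `eventually_kappa3_ne_zero`). -/
theorem eventually_ne_zero_of_skewnessForPackageMap (h : SkewnessForPackageMap) :
    ∀ (G : Type) [Group G] [TopologicalSpace G] [IsTopologicalGroup G] [CompactSpace G],
      IsCompactSimpleLieGroup G →
        letI : MeasurableSpace G := borel G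
        haveI : BorelSpace G := ⟨rfl⟩
        ∀ (r : LatticeRep G), (∃ a : ℝ → ℝ, TwoPointPackage r a) →
          ∀ (L : ℕ) [NeZero L] (n : ℕ), 1 ≤ n → 8 * n ≤ L → ∀ᶠ β in atTop, kappa3 r L β n ≠ 0 := by
  intro G _ _ _ _ hG
  letI : MeasurableSpace G := borel G
  haveI : BorelSpace G := ⟨rfl⟩
  intro r hex L _ n hn h8
  obtain ⟨a, hP, hS⟩ := h G hG r hex
  obtain ⟨Γ, β₀, ℓ₀, c, C, -, -, ha, ha0, -⟩ := id hP
  exact eventually_kappa3_ne_zero r ha ha0 hS L n hn h8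

/-- **R1 ⟺ fixed-torus eventual non-vanishing given a package map.**  The ∃-bundled (assembly-sufficient) form of crux
`FemtoCurvatureSkewness` says exactly: for every compact simple `G` and every lattice representation `r` for which SOME unit map
carries the two-point package of `FemtoCurvatureTwoPoint`, on every torus `(ℤ/L)⁴` and every separation `1 ≤ n ≤ L/8` the third
cumulant `κ₃(P_0^{01}, P_{ne₂}^{01}, P_{ne₃}^{01})` is non-zero for all sufficiently large `β`.  (The recommended restatement
of item 9365: the right-hand side, verbatim.) -/
theorem skewnessForPackageMap_iff_eventually_ne_zero : SkewnessForPackageMap ↔ ∀ (G : Type) [Group G] [TopologicalSpace G] [IsTopologicalGroup G] [CompactSpace G], IsCompactSimpleLieGroup G → letI : MeasurableSpace G := borel G; haveI : BorelSpace G := ⟨rfl⟩; ∀ (r : LatticeRep G), (∃ a : ℝ → ℝ, TwoPointPackage r a) → ∀ (L : ℕ) [NeZero L] (n : ℕ), 1 ≤ n → 8 * n ≤ L → ∀ᶠ β in atTop, kappa3 r L β n ≠ 0 :=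
  ⟨eventually_ne_zero_of_skewnessForPackageMap, skewnessForPackageMap_of_eventually_ne_zero⟩

/-! ## Where the line's engine and the typed crux sit relative to it -/

/-- **The engine stub E is (much) more than R1 needs**: `MarkedCouplingDominance` forces `κ₃ > 0` on the femto boxes of its own
honest map (`kappa3_pos_of_dominance`), and every fixed torus enters those boxes as `β → ∞`; so E implies the eventual
non-vanishing, and c1's `skewnessForPackageMap_of` factors as E ⟹ eventual non-vanishing ⟹ R1. -/
theorem eventually_ne_zero_of_markedCouplingDominance (hE : MarkedCouplingDominance) :
    ∀ (G : Type) [Group G] [TopologicalSpace G] [IsTopologicalGroup G] [CompactSpace G],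
      IsCompactSimpleLieGroup G →
        letI : MeasurableSpace G := borel G
        haveI : BorelSpace G := ⟨rfl⟩
        ∀ (r : LatticeRep G), (∃ a : ℝ → ℝ, TwoPointPackage r a) →
          ∀ (L : ℕ) [NeZero L] (n : ℕ), 1 ≤ n → 8 * n ≤ L → ∀ᶠ β in atTop, kappa3 r L β n ≠ 0 := by
  intro G _ _ _ _ hG
  letI : MeasurableSpace G := borel G
  haveI : BorelSpace G := ⟨rfl⟩
  intro r hex L _ n hn h8
  obtain ⟨a, hhon, -, hD⟩ := hE G hG r hex
  obtain ⟨β₁, ℓ₁, hℓ₁, hpos⟩ := kappa3_pos_of_dominance r a hD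
  have hLpos : (0 : ℝ) < L := by
    have h8' : (8 : ℝ) * n ≤ L := by exact_mod_cast h8
    have hn' : (1 : ℝ) ≤ n := by exact_mod_cast hn
    linarith
  have hev : ∀ᶠ β in atTop, a β ∈ Set.Iio (ℓ₁ / L) :=
    hhon.2.1.eventually_mem (Iio_mem_nhds (div_pos hℓ₁ hLpos))
  filter_upwards [hev, eventually_ge_atTop β₁] with β hβ hβ₁
  have hLa : (L : ℝ) * a β ≤ ℓ₁ := by
    have hlt : a β < ℓ₁ / L := hβ
    rw [lt_div_iff₀ hLpos] at hlt
    linarith [mul_comm (a β) (L : ℝ)]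
  exact ((hpos L β hβ₁ hLa n hn h8).2).ne'

/-- **The typed `∀ a` crux implies the eventual non-vanishing** (landing the disprover's `crux_forces_eventual_nonvanishing`): apply
it to the given package map and use `eventually_kappa3_ne_zero`.  Together with `skewnessForPackageMap_iff_eventually_ne_zero`:
typed crux ⟹ R1, and the surplus of the typed shell is purely infrared (`kappa3_ne_zero_of_femtoCurvatureSkewness`, p115717). -/
theorem eventually_ne_zero_of_femtoCurvatureSkewness (hcrux : FemtoCurvatureSkewness) :
    ∀ (G : Type) [Group G] [TopologicalSpace G] [IsTopologicalGroup G] [CompactSpace G],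
      IsCompactSimpleLieGroup G →
        letI : MeasurableSpace G := borel G
        haveI : BorelSpace G := ⟨rfl⟩
        ∀ (r : LatticeRep G), (∃ a : ℝ → ℝ, TwoPointPackage r a) →
          ∀ (L : ℕ) [NeZero L] (n : ℕ), 1 ≤ n → 8 * n ≤ L → ∀ᶠ β in atTop, kappa3 r L β n ≠ 0 := by
  intro G _ _ _ _ hG
  letI : MeasurableSpace G := borel G
  haveI : BorelSpace G := ⟨rfl⟩
  intro r hex L _ n hn h8
  obtain ⟨a, ha⟩ := hex
  obtain ⟨Γ, β₀, ℓ₀, c, C, -, -, hapos, ha0, -⟩ := id ha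
  exact eventually_kappa3_ne_zero r hapos ha0 (femtoCurvatureSkewness_iff.1 hcrux G hG r a ha) L n hn h8

/-! ## What a line for the restated item has to prove: a non-zero leading Laplace coefficient per torus -/

section LeadingOrder

variable {G : Type} [Group G] [TopologicalSpace G] [IsTopologicalGroup G] [CompactSpace G]
  [MeasurableSpace G] [BorelSpace G]

/-- **Leading-order asymptotics ⇒ eventual non-vanishing** (the shape of the natural line for the restated item): if on the torus
`(ℤ/L)⁴` at separation `n` the cumulant has a NON-ZERO leading weak-coupling coefficient, `βᵖ · κ₃(L, β, n) → T ≠ 0` for some exponent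
`p` (tree level: `p = 3`, `T` = the triangle `8·T_r³·dim G·G_L(ne₂)²·G_L(n(e₃−e₂))` plus a constant-mode / toron term), then
`κ₃(L, β, n) ≠ 0` for all large `β`.  The entire difficulty of the restated item is the singular Laplace asymptotics producing `T` and
its non-vanishing for every `(G, r, L, n)`. -/
theorem eventually_ne_zero_of_leadingOrder (r : LatticeRep G) (L : ℕ) [NeZero L] (n : ℕ) {p T : ℝ} (hT : T ≠ 0)
    (hlim : Tendsto (fun β : ℝ => β ^ p * kappa3 r L β n) atTop (𝓝 T)) :
    ∀ᶠ β in atTop, kappa3 r L β n ≠ 0 := by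
  have hne : ∀ᶠ β in atTop, β ^ p * kappa3 r L β n ≠ 0 := hlim.eventually_ne hT
  filter_upwards [hne] with β hβ
  exact fun h0 => hβ (by rw [h0, mul_zero])

end LeadingOrder

end Summit.QuantumFields.YangMills.Cruxes.FemtoCurvatureSkewness.CouplingCubicResponse

end
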